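import Summits.QuantumFields.BalabanUV.T4Continuum.Support.NE7K1LinWalkLineSeries
import Summits.QuantumFields.BalabanUV.T4Continuum.Support.NE7K1LinWalkRegion
import Literature.MathematicalPhysics.QuantumFieldTheory.Balaban1983to89.B4Prop31Zero

/-!
# NE7K1LinWalkLineRegion — row NE7 (node U5), candidate route HOM, path H1L, cell K1-lin(s): THE TWO-CUTOFF LINE's s-UNIFORM
# RANDOM-WALK EXPANSION AT U = 1 ON A GENERAL REGION — gen 69's `NE7K1LinWalkLineWalk` (coarse sites = an aligned box) re-run with the
# coarse sites ANY UNION OF BIG BLOCKS, same constants `α♮, β♮, σ♮, τ♮`, same threshold `M ≥ M₀(d,L,a)`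

Lineage `b2b-balaban-t4-ne7-p2` (CRUX PROVER NE7 #2), generation 70; series (RW) file 20, over files 14 ∕ 17 `NE7K1LinWalkLineWalk` ∕ `…Series` (file 14's
`hbox`-free lemmas `cutoffOn_line`, `cut_ind_bounds_line`, `disjoint_line`, `count_overlap_line`, `count_cover_line`, `extLine_coercive'`,
`lineSigma_pos`, `alpha_line_eq`, `beta_line_le`, `sum_filter_nbrs_transport` are used BY NAME) and file 18 `NE7K1LinWalkRegion` (the Neumann
second difference of the product cut-offs on a region, the partition of unity on a region).  [Balaban1983RegularityDecay] = T. Bałaban,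
Commun. Math. Phys. 89 (1983) 571–597, §1 p. 572 («Ω a union of big blocks»), §2.

WHAT CHANGES AGAINST FILE 14: its two uses of `hbox : R′.image (blk L) = Π_μ[0,(2K_μ+1)Mn)` — the Neumann second difference
(`NE7K1LinWalkBox.abs_sum_nbrs_cut_sub_le`) inside (H-comm) and the partition of unity (`NE7K1LinWalkCubes.sum_cut_eq_one`) — are replaced by
`hreg : R′.image (blk L) = reg (Mn) K C` (the coarse sites of the fine region `R′` form a region over an ARBITRARY cell set `C`) and file
18's `abs_sum_nbrs_cut_sub_le_region` ∕ `sum_cut_eq_one_region`, which carry the SAME constants; everything else is file 14 verbatim by name.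
* `hcomm_line_region`, (private) `sum_cut_mul_ind_line_region`, `l2_opNorm_remainder_line_region` — the three `hbox`-dependent steps on a region;
* **`hasSum_extLine_walk_region`** — for `3^{d+1}·τ♮ < 1` the random-walk expansion of `(𝒫♮(s))⁻¹` over the `M`-cubes CONVERGES for EVERY
  `s ∈ [0,1]`, every mesh and every region; **`hasSum_twoCutoffLine_walk_blockUnion`** — its coarse blocks sum to `(twoCutoffLine s)⁻¹`
  when the coarse sites are any union of big blocks (file 17's `hasSum_toBlocks₁₁` ∕ `toBlocks₁₁_inv_extLine` BY NAME): B4 (2.12)'s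
  representation for the line's propagator on a region;
* **`twoCutoffLine_inv_entry_decay_region`** — `|(twoCutoffLine s)⁻¹(x,y)| ≤ 3^{d+1}σ′⁻¹τ♮·3^{d+1}(3^{d+1}τ♮)^{N−1}∕(1 − 3^{d+1}τ♮)` whenever
  `|x_μ − y_μ| ≥ (2N+3)Mn + n` in some coordinate: THE K1-lin(s) LINE's PROPAGATOR DECAYS GEOMETRICALLY ACROSS M-CUBES WITH CONSTANTS FREE OF
  `s`, OF THE MESH AND OF THE REGION;
* §2b **`twoCutoffLine_inv_entry_decay_blockUnion`** — the same with the hypothesis in B4's words: the coarse sites `R′.image (blk L)`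
  are ANY union of `Mn`-blocks inside the bounding box (`reg_image_blk_eq`);
* §3 the CONCRETE fine region `R′ = fineDom L (reg (Mn) K C)` (the `η_B`-sites over the coarse region): `isBlockUnion_fineDom_mul`,
  **`hasSum_lineRegion_walk`**, **`twoCutoffLine_inv_entry_decay_fineRegion`** — no hypothesis beyond `n ≥ 1`, `M ≥ 3`, `a > 0`, `s ∈ [0,1]`,
  `3^{d+1}τ♮ < 1`; gen 69's `NE7K1LinWalkLineBox` is the case `C ⊇` all cells.

HONEST FRAMING: [folklore] assembly; A = 0, U = 1, one scale, crude constants (`NE7K1LinWalkLineThreshold`'s `M₀(d,L,a)` unchanged);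
census only (cell K1-lin(s)'s «template application», random-walk half, now on every union of big blocks for the endpoint AND the line);
nothing of Bałaban's asserted; no `sorry`.  NO letter ∕ tag ∕ size of NE7 moves; NE7 NOT PRINTED ∕ NOT PROVED; spine 0∕9; FIXED FINITE T⁴,
rung (B)+1; NOT infinite volume, NOT mass gap, NOT Clay.  HONEST DEPENDENCY: continuum YM on T⁴ ⇐ BetaPertH ∧ nine spine estimates (0/9
proved); BetaPertH ⇐ (D1) ∧ (D4) ∧ CAP+tail; G-an2-4 gates asym, D1 and NE2/3/4.
-/

noncomputable section

open Finset Matrix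
open scoped Matrix.Norms.L2Operator

namespace Summit.QuantumFields.BalabanUV.T4Continuum.NE7K1LinWalkLineRegion

open Literature.MathematicalPhysics.QuantumFieldTheory.Balaban1983to89
open Literature.MathematicalPhysics.QuantumFieldTheory.Balaban1983to89.B4Reflection242
open Literature.MathematicalPhysics.QuantumFieldTheory.Balaban1983to89.B4BoxCov237
open Literature.MathematicalPhysics.QuantumFieldTheory.Balaban1983to89.B4Lower18
open Literature.MathematicalPhysics.QuantumFieldTheory.Balaban1983to89.B4Prop31Zero (image_blk_fineDom)
open NE7K1LinBlockCoords NE7K1LinSchurLineU1 NE7K1LinWalkParametrix NE7K1LinWalkSmallness NE7K1LinWalkExpansion NE7K1LinWalkCubes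
  NE7K1LinWalkBox NE7K1LinWalkFineOp NE7K1LinWalkLine NE7K1LinWalkLineHcomm NE7K1LinWalkLineWalk NE7K1LinWalkLineSeries NE7K1LinWalkRegion

variable {d : ℕ}

section Instance

variable {n L M : ℕ} [NeZero L] {R' : Finset (Fin (d + 1) → ℤ)} (K : Fin (d + 1) → ℕ) (C : Finset (Fin (d + 1) → ℤ))
  (hn : 1 ≤ n) (hM : 3 ≤ M) (hR' : IsBlockUnion (n * L) R') (hreg : R'.image (blk L) = reg (M * n) K C) {a : ℝ} (ha : 0 < a)
  {s : ℝ} (hs0 : 0 ≤ s) (hs1 : s ≤ 1)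

/-! ### §1 The three `hbox`-dependent steps of file 14, on a region -/

include hn hM hR' hreg ha hs0 hs1 in
/-- **(H-comm) FOR `𝒫♮(s)` WITH THE LINE'S CONSTANTS, COARSE SITES A REGION**: `‖[diag(cut_J∘site), 𝒫♮(s)]w‖² ≤ α♮⟨w,𝒫♮(s)w⟩ + β♮‖w‖²` —
file 13 at `ℓ₁ = 4∕(Mn)`, `ℓ₂ = 32(d+1)∕(Mn)²`, `ℓ₃ = 4(d+1)n∕(Mn)`, the Neumann second difference by `NE7K1LinWalkRegion.abs_sum_nbrs_cut_sub_le_region`.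
[folklore] -/
theorem hcomm_line_region (J : Lab K) (w : Idx L R' → ℝ) :
    comm (fun c : Idx L R' => cut (M * n) J.1 (site c).1) (extLine (isBlockUnion_fine hR') n a s) *ᵥ w ⬝ᵥ
        comm (fun c : Idx L R' => cut (M * n) J.1 (site c).1) (extLine (isBlockUnion_fine hR') n a s) *ᵥ w ≤
      lineAlpha2 d L M * (w ⬝ᵥ (extLine (isBlockUnion_fine hR') n a s) *ᵥ w) + lineBeta2 d L M a * (w ⬝ᵥ w) := by
  obtain ⟨hW, hW2, -⟩ := scale_facts hn hM
  have h := comm_extLine_sq_le hn hR' ha hs0 hs1 (fun b : ↥(R'.image (blk L)) => cut (M * n) J.1 b.1)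
    (ℓ₁ := 4 / ((M * n : ℕ) : ℝ)) (ℓ₂ := 32 * ((d : ℝ) + 1) / ((M * n : ℕ) : ℝ) ^ 2) (ℓ₃ := 4 * ((d : ℝ) + 1) * n / ((M * n : ℕ) : ℝ))
    (by positivity) (by positivity)
    (fun x y hxy => abs_cut_sub_cut_of_mem_nbrs hW J.1 hxy)
    (fun x => by
      have hx : x.1 ∈ reg (M * n) K C := by rw [← hreg]; exact x.2
      rw [sum_filter_nbrs_transport hreg (fun u v => cut (M * n) J.1 u - cut (M * n) J.1 v) x.1]
      exact abs_sum_nbrs_cut_sub_le_region hW2 K C J.1 ⟨x.1, hx⟩)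
    (fun x y hxy => abs_cut_sub_cut_of_blk_eq hW hn J.1 hxy) w
  have hform : 0 ≤ w ⬝ᵥ (extLine (isBlockUnion_fine hR') n a s) *ᵥ w :=
    le_trans (mul_nonneg (le_min (by positivity) (by positivity)) (Finset.sum_nonneg fun i _ => mul_self_nonneg _))
      (extLine_coercive hn hR' ha hs0 hs1 w)
  have hww : 0 ≤ w ⬝ᵥ w := Finset.sum_nonneg fun i _ => mul_self_nonneg _
  refine h.trans ?_
  exact add_le_add (mul_le_mul_of_nonneg_right (alpha_line_eq hn hM).le hform)
    (mul_le_mul_of_nonneg_right (beta_line_le hn hM a) hww)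

include hreg in
/-- **PARTITION OF UNITY** `Σ_J Λ_J r_J ≡ 1` on `Idx` (the coarse PoU at `site c`, from `NE7K1LinWalkRegion.sum_cut_eq_one_region`);
file 14's `sum_cut_mul_ind_line` with `hbox` replaced by `hreg` (kept private: same display, different hypothesis). [folklore] -/
private theorem sum_cut_mul_ind_line_region (hW : 1 ≤ M * n) (c : Idx L R') :
    ∑ J : Lab K, cut (M * n) J.1 (site c).1 *
      (if c ∈ univ.filter (fun c : Idx L R' => site c ∈ region (R'.image (blk L)) (M * n) n J.1) then (1 : ℝ) else 0) = 1 := by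
  have h1 : ∀ J : Lab K, cut (M * n) J.1 (site c).1 *
      (if c ∈ univ.filter (fun c : Idx L R' => site c ∈ region (R'.image (blk L)) (M * n) n J.1) then (1 : ℝ) else 0) =
      cut (M * n) J.1 (site c).1 := by
    intro J
    by_cases h : cut (M * n) J.1 (site c).1 = 0
    · rw [h, zero_mul]
    · rw [if_pos (show c ∈ univ.filter (fun c : Idx L R' => site c ∈ region (R'.image (blk L)) (M * n) n J.1) from
        Finset.mem_filter.2 ⟨Finset.mem_univ _, mem_region_self_of_cut_ne_zero hW h⟩), mul_one]
  simp_rw [h1]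
  have hx : (site c).1 ∈ reg (M * n) K C := by rw [← hreg]; exact (site c).2
  rw [Finset.sum_coe_sort (labs K) (fun J' => cut (M * n) J' (site c).1)]
  exact sum_cut_eq_one_region hW K C hx

include hn hM hR' hreg ha hs0 hs1 in
/-- **THE REMAINDER IS SMALL, UNIFORMLY IN `s` AND IN THE REGION**: `‖R(s)‖ ≤ 3^{d+1}·τ♮`. [folklore] -/
theorem l2_opNorm_remainder_line_region :
    ‖∑ J : Lab K, bPiece (extLine (isBlockUnion_fine hR') n a s) (fun c : Idx L R' => cut (M * n) J.1 (site c).1)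
        (fun c => if c ∈ univ.filter (fun c : Idx L R' => site c ∈ region (R'.image (blk L)) (M * n) n J.1) then (1 : ℝ) else 0)
        (univ.filter fun c : Idx L R' => site c ∈ region (R'.image (blk L)) (M * n) n J.1)‖ ≤ (3 : ℝ) ^ (d + 1) * lineTau d L M a := by
  classical
  obtain ⟨hW, hW2, hρ⟩ := scale_facts hn hM
  have hM0 : (0 : ℝ) < M := Nat.cast_pos.2 (by omega)
  have hα : 0 ≤ lineAlpha2 d L M := by unfold lineAlpha2; positivity
  have hβ : 0 ≤ lineBeta2 d L M a := by unfold lineBeta2; positivity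
  have h := l2_opNorm_remainder_le (extLine (isBlockUnion_fine hR') n a s) (lineSigma_pos ha) (extLine_coercive' hn hR' ha hs0 hs1)
    (fun J : Lab K => fun c : Idx L R' => cut (M * n) J.1 (site c).1)
    (fun J c => if c ∈ univ.filter (fun c : Idx L R' => site c ∈ region (R'.image (blk L)) (M * n) n J.1) then (1 : ℝ) else 0)
    (fun J => univ.filter fun c : Idx L R' => site c ∈ region (R'.image (blk L)) (M * n) n J.1)
    (cutoffOn_line K hn hR' hW) (fun J c => (cut_ind_bounds_line K J c).2.2) (fun J c => (cut_ind_bounds_line K J c).2.1) hα hβ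
    (hcomm_line_region K C hn hM hR' hreg ha hs0 hs1)
    (fun J => count_overlap_line K hρ _ (fun J c hc => (Finset.mem_filter.1 hc).2) J) fun c => (count_cover_line K hW hρ c).1
  refine h.trans (le_of_eq ?_)
  rw [lineTau, ← Real.sqrt_sq (by positivity : (0 : ℝ) ≤ (3 : ℝ) ^ (d + 1)), ← Real.sqrt_mul (by positivity)]
  congr 1; push_cast; ring

/-! ### §2 The convergent expansion of `(𝒫♮(s))⁻¹` and the decay of `(twoCutoffLine s)⁻¹` on a region -/

include hn hM hR' hreg ha hs0 hs1 in
/-- **THE RANDOM-WALK EXPANSION OF `(𝒫♮(s))⁻¹` CONVERGES, UNIFORMLY IN `s ∈ [0,1]`, IN THE MESH AND IN THE REGION**: for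
`3^{d+1}·τ♮ < 1`, `HasSum (k ↦ G₀(s)R(s)^k) (𝒫♮(s))⁻¹` in the `ℓ²`-operator norm — B4 (2.12)–(2.13) for the two-cutoff line at U = 1
whose coarse sites are ANY union of big blocks. [cite: Balaban1983RegularityDecay, (2.12)–(2.13) p.577, case A = 0] [folklore] -/
theorem hasSum_extLine_walk_region (hsmall : (3 : ℝ) ^ (d + 1) * lineTau d L M a < 1) :
    HasSum (fun k : ℕ =>
      (∑ J : Lab K, aPiece (extLine (isBlockUnion_fine hR') n a s) (fun c : Idx L R' => cut (M * n) J.1 (site c).1)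
        (fun c => if c ∈ univ.filter (fun c : Idx L R' => site c ∈ region (R'.image (blk L)) (M * n) n J.1) then (1 : ℝ) else 0)
        (univ.filter fun c : Idx L R' => site c ∈ region (R'.image (blk L)) (M * n) n J.1)) *
      (∑ J : Lab K, bPiece (extLine (isBlockUnion_fine hR') n a s) (fun c : Idx L R' => cut (M * n) J.1 (site c).1)
        (fun c => if c ∈ univ.filter (fun c : Idx L R' => site c ∈ region (R'.image (blk L)) (M * n) n J.1) then (1 : ℝ) else 0)
        (univ.filter fun c : Idx L R' => site c ∈ region (R'.image (blk L)) (M * n) n J.1)) ^ k)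
      (extLine (isBlockUnion_fine hR') n a s)⁻¹ := by
  obtain ⟨hW, -, -⟩ := scale_facts hn hM
  exact hasSum_walk_expansion _ (lineSigma_pos ha) (extLine_coercive' hn hR' ha hs0 hs1) _ _ _ (cutoffOn_line K hn hR' hW)
    (sum_cut_mul_ind_line_region K C hreg hW) ((l2_opNorm_remainder_line_region K C hn hM hR' hreg ha hs0 hs1).trans_lt hsmall)

include hn hM ha hs0 hs1 in
/-- **THE RANDOM-WALK REPRESENTATION OF THE LINE's PROPAGATOR, COARSE SITES ANY UNION OF BIG BLOCKS**: if the coarse sites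
`R′.image (blk L)` form a union of `Mn`-blocks inside `Π_μ[0,(2K_μ+1)Mn)`, then `HasSum (k ↦ [G₀(s)·R(s)^k]₁₁) (twoCutoffLine s)⁻¹` for
`3^{d+1}τ♮ < 1`, every `s ∈ [0,1]`, every mesh (file 17's `hasSum_toBlocks₁₁` ∕ `toBlocks₁₁_inv_extLine` BY NAME on
`hasSum_extLine_walk_region`, the cell set read off by `NE7K1LinWalkRegion.reg_image_blk_eq`).
[cite: Balaban1983RegularityDecay, (2.12) p.577, case A = 0, shape] [folklore] -/
theorem hasSum_twoCutoffLine_walk_blockUnion (hRc : IsBlockUnion (M * n) (R'.image (blk L)))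
    (hRbox : R'.image (blk L) ⊆ boxDom (fun μ => (2 * K μ + 1) * (M * n))) (hsmall : (3 : ℝ) ^ (d + 1) * lineTau d L M a < 1) :
    HasSum (fun k : ℕ =>
      ((∑ J : Lab K, aPiece (extLine (isBlockUnion_fine hR') n a s) (fun c : Idx L R' => cut (M * n) J.1 (site c).1)
          (fun c => if c ∈ univ.filter (fun c : Idx L R' => site c ∈ region (R'.image (blk L)) (M * n) n J.1) then (1 : ℝ) else 0)
          (univ.filter fun c : Idx L R' => site c ∈ region (R'.image (blk L)) (M * n) n J.1)) *
        (∑ J : Lab K, bPiece (extLine (isBlockUnion_fine hR') n a s) (fun c : Idx L R' => cut (M * n) J.1 (site c).1)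
          (fun c => if c ∈ univ.filter (fun c : Idx L R' => site c ∈ region (R'.image (blk L)) (M * n) n J.1) then (1 : ℝ) else 0)
          (univ.filter fun c : Idx L R' => site c ∈ region (R'.image (blk L)) (M * n) n J.1)) ^ k).toBlocks₁₁)
      (twoCutoffLine (isBlockUnion_fine hR') n a s)⁻¹ := by
  rw [← toBlocks₁₁_inv_extLine hn hR' ha hs0]
  exact hasSum_toBlocks₁₁ (hasSum_extLine_walk_region K ((R'.image (blk L)).image (blk (M * n))) hn hM hR'
    (reg_image_blk_eq hRc hRbox).symm ha hs0 hs1 hsmall)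

include hn hM hR' hreg ha hs0 hs1 in
/-- **THE TWO-CUTOFF LINE'S PROPAGATOR DECAYS GEOMETRICALLY ACROSS `M`-CUBES, WITH CONSTANTS FREE OF `s`, OF THE MESH AND OF THE REGION**:
for `3^{d+1}τ♮ < 1`, every `s ∈ [0,1]` and coarse sites `x, y` of the region with `|x_μ − y_μ| ≥ (2N+3)Mn + n` in some coordinate (`N ≥ 1`),
`|(twoCutoffLine s)⁻¹(x,y)| ≤ 3^{d+1}·(min(σ♮,1))⁻¹·τ♮·3^{d+1}·(3^{d+1}τ♮)^{N−1}∕(1 − 3^{d+1}τ♮)` — B4 (2.22)∕(2.30)'s shape for the K1-lin(s)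
line at U = 1 (read off on the coarse block, `NE7K1LinWalkLine.extLine_inv_inl_inl`), no restriction `dist(x, Ω^c) ≥ R₀`.
[cite: Balaban1983RegularityDecay, (2.22) p.579, Corollary 2.3 (2.30) pp.580–581, case A = 0] [folklore] -/
theorem twoCutoffLine_inv_entry_decay_region (hsmall : (3 : ℝ) ^ (d + 1) * lineTau d L M a < 1) (x y : ↥(R'.image (blk L)))
    {N : ℕ} (hN : 1 ≤ N) (hfar : ∃ μ, (((2 * N + 3) * (M * n) + n : ℕ) : ℤ) ≤ |x.1 μ - y.1 μ|) :
    |(twoCutoffLine (isBlockUnion_fine hR') n a s)⁻¹ x y| ≤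
      (3 : ℝ) ^ (d + 1) * (1 / min (lineSigma d L a) 1) * lineTau d L M a * (3 : ℝ) ^ (d + 1) *
        ((3 : ℝ) ^ (d + 1) * lineTau d L M a) ^ (N - 1) / (1 - (3 : ℝ) ^ (d + 1) * lineTau d L M a) := by
  classical
  obtain ⟨hW, hW2, hρ⟩ := scale_facts hn hM
  have hM0 : (0 : ℝ) < M := Nat.cast_pos.2 (by omega)
  have hα : 0 ≤ lineAlpha2 d L M := by unfold lineAlpha2; positivity
  have hβ : 0 ≤ lineBeta2 d L M a := by unfold lineBeta2; positivity
  obtain ⟨μ, hμ⟩ := hfar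
  rw [← extLine_inv_inl_inl hn hR' ha hs0 x y]
  have h := inv_entry_decay (labPos K) (labPos_injective K) (extLine (isBlockUnion_fine hR') n a s) (lineSigma_pos ha)
    (extLine_coercive' hn hR' ha hs0 hs1) (fun J : Lab K => fun c : Idx L R' => cut (M * n) J.1 (site c).1)
    (fun J c => if c ∈ univ.filter (fun c : Idx L R' => site c ∈ region (R'.image (blk L)) (M * n) n J.1) then (1 : ℝ) else 0)
    (fun J => univ.filter fun c : Idx L R' => site c ∈ region (R'.image (blk L)) (M * n) n J.1)
    (fun J J' hJJ' => disjoint_line K hρ hJJ') (cutoffOn_line K hn hR' hW) (sum_cut_mul_ind_line_region K C hreg hW)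
    zero_le_one (fun J c => (cut_ind_bounds_line K J c).1) (fun J c => (cut_ind_bounds_line K J c).2.2)
    (fun J c => (cut_ind_bounds_line K J c).2.1) hα hβ (hcomm_line_region K C hn hM hR' hreg ha hs0 hs1)
    (by rw [lineTau] at hsmall; exact hsmall) ((l2_opNorm_remainder_line_region K C hn hM hR' hreg ha hs0 hs1).trans_lt hsmall)
    (Sum.inl x) (Sum.inl y) (count_cover_line K hW hρ (Sum.inl x)).2 hN
    (fun J hJ J' hJ' => ⟨μ, label_sep_of_far hW hJ (Finset.mem_filter.1 (((cut_ind_bounds_line K J' (Sum.inl y)).2.2) hJ')).2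
      (by exact_mod_cast hμ)⟩)
  rw [lineTau]
  refine h.trans (le_of_eq ?_)
  push_cast
  ring

/-! ### §2b The same with the region hypothesis in B4's words: the coarse sites are ANY union of big blocks -/

include hn hM ha hs0 hs1 in
/-- **THE LINE's PROPAGATOR DECAY FOR COARSE SITES ANY UNION OF BIG BLOCKS**: if the coarse sites `R′.image (blk L)` of the fine region
`R′` (a union of `nL`-blocks) form a union of `Mn`-blocks inside `Π_μ[0,(2K_μ+1)Mn)`, then for `3^{d+1}τ♮ < 1`, every `s ∈ [0,1]` and coarse
sites with `|x_μ − y_μ| ≥ (2N+3)Mn + n` in some coordinate: `|(twoCutoffLine s)⁻¹(x,y)| ≤ 3^{d+1}σ′⁻¹τ♮·3^{d+1}(3^{d+1}τ♮)^{N−1}∕(1 − 3^{d+1}τ♮)`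
(`twoCutoffLine_inv_entry_decay_region` with `C` the cell set of the coarse sites, `NE7K1LinWalkRegion.reg_image_blk_eq`).
[cite: Balaban1983RegularityDecay, (2.22) p.579, Corollary 2.3 (2.30) pp.580–581, case A = 0, shape] [folklore] -/
theorem twoCutoffLine_inv_entry_decay_blockUnion (hRc : IsBlockUnion (M * n) (R'.image (blk L)))
    (hRbox : R'.image (blk L) ⊆ boxDom (fun μ => (2 * K μ + 1) * (M * n))) (hsmall : (3 : ℝ) ^ (d + 1) * lineTau d L M a < 1)
    (x y : ↥(R'.image (blk L))) {N : ℕ} (hN : 1 ≤ N) (hfar : ∃ μ, (((2 * N + 3) * (M * n) + n : ℕ) : ℤ) ≤ |x.1 μ - y.1 μ|) :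
    |(twoCutoffLine (isBlockUnion_fine hR') n a s)⁻¹ x y| ≤
      (3 : ℝ) ^ (d + 1) * (1 / min (lineSigma d L a) 1) * lineTau d L M a * (3 : ℝ) ^ (d + 1) *
        ((3 : ℝ) ^ (d + 1) * lineTau d L M a) ^ (N - 1) / (1 - (3 : ℝ) ^ (d + 1) * lineTau d L M a) :=
  twoCutoffLine_inv_entry_decay_region K ((R'.image (blk L)).image (blk (M * n))) hn hM hR' (reg_image_blk_eq hRc hRbox).symm
    ha hs0 hs1 hsmall x y hN hfar

end Instance

/-! ### §3 The concrete fine region over a coarse region -/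

section Concrete

variable {n L M : ℕ} [NeZero L] (K : Fin (d + 1) → ℕ) (C : Finset (Fin (d + 1) → ℤ))

/-- the fine region over a region that is a union of `n`-blocks is a union of `nL`-blocks. [folklore] -/
theorem isBlockUnion_fineDom_mul {Ω : Finset (Fin (d + 1) → ℤ)} (hΩ : IsBlockUnion n Ω) : IsBlockUnion (n * L) (fineDom L Ω) := by
  have hL : 1 ≤ L := NeZero.one_le
  intro x hx z hz
  rw [mem_fineDom hL] at hx ⊢
  have h : blk n (blk L z) = blk n (blk L x) := by rw [blk_blk_mul, blk_blk_mul, hz]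
  exact hΩ hx h

/-- **THE FINE REGION `R′ = fineDom L (reg (Mn) K C)`** (the `η_B`-sites over the coarse region) is a union of `nL`-blocks. [folklore] -/
theorem isBlockUnion_lineRegion (hn : 1 ≤ n) (M : ℕ) : IsBlockUnion (n * L) (fineDom L (reg (M * n) K C)) :=
  isBlockUnion_fineDom_mul (reg_isBlockUnion_fine hn M K C)

/-- its coarse sites are the region. [folklore] -/
theorem image_blk_lineRegion (n M : ℕ) : (fineDom L (reg (M * n) K C)).image (blk L) = reg (M * n) K C :=
  image_blk_fineDom NeZero.one_le _

variable (hn : 1 ≤ n) (hM : 3 ≤ M) {a : ℝ} (ha : 0 < a) {s : ℝ} (hs0 : 0 ≤ s) (hs1 : s ≤ 1)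

include hM ha hs0 hs1 in
/-- **THE RANDOM-WALK EXPANSION OF `(𝒫♮(s))⁻¹` ON THE FINE REGION OVER ANY COARSE REGION CONVERGES**, for every `s ∈ [0,1]`, once
`3^{d+1}τ♮ < 1`. [folklore] -/
theorem hasSum_lineRegion_walk (hsmall : (3 : ℝ) ^ (d + 1) * lineTau d L M a < 1) :
    HasSum (fun k : ℕ =>
      (∑ J : Lab K, aPiece (extLine (isBlockUnion_fine (isBlockUnion_lineRegion K C hn M)) n a s)
        (fun c : Idx L (fineDom L (reg (M * n) K C)) => cut (M * n) J.1 (site c).1)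
        (fun c => if c ∈ univ.filter (fun c : Idx L (fineDom L (reg (M * n) K C)) =>
          site c ∈ region ((fineDom L (reg (M * n) K C)).image (blk L)) (M * n) n J.1) then (1 : ℝ) else 0)
        (univ.filter fun c : Idx L (fineDom L (reg (M * n) K C)) =>
          site c ∈ region ((fineDom L (reg (M * n) K C)).image (blk L)) (M * n) n J.1)) *
      (∑ J : Lab K, bPiece (extLine (isBlockUnion_fine (isBlockUnion_lineRegion K C hn M)) n a s)
        (fun c : Idx L (fineDom L (reg (M * n) K C)) => cut (M * n) J.1 (site c).1)
        (fun c => if c ∈ univ.filter (fun c : Idx L (fineDom L (reg (M * n) K C)) =>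
          site c ∈ region ((fineDom L (reg (M * n) K C)).image (blk L)) (M * n) n J.1) then (1 : ℝ) else 0)
        (univ.filter fun c : Idx L (fineDom L (reg (M * n) K C)) =>
          site c ∈ region ((fineDom L (reg (M * n) K C)).image (blk L)) (M * n) n J.1)) ^ k)
      (extLine (isBlockUnion_fine (isBlockUnion_lineRegion K C hn M)) n a s)⁻¹ :=
  hasSum_extLine_walk_region K C hn hM (isBlockUnion_lineRegion K C hn M) (image_blk_lineRegion K C n M) ha hs0 hs1 hsmall

include hM ha hs0 hs1 in
/-- **THE K1-lin(s) TWO-CUTOFF LINE'S PROPAGATOR ON ANY UNION OF BIG BLOCKS DECAYS GEOMETRICALLY ACROSS `M`-CUBES, UNIFORMLY IN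
`s ∈ [0,1]`, IN THE MESH AND IN THE REGION**: for `n ≥ 1`, `M ≥ 3`, `a > 0`, `3^{d+1}τ♮(d,L,M,a) < 1`, every `s ∈ [0,1]`, every cell set
`C` and coarse sites `x, y` of `reg (Mn) K C` with `|x_μ − y_μ| ≥ (2N+3)Mn + n` in some coordinate (`N ≥ 1`):
`|(twoCutoffLine s)⁻¹(x,y)| ≤ 3^{d+1}·(min(σ♮,1))⁻¹·τ♮·3^{d+1}·(3^{d+1}τ♮)^{N−1}∕(1 − 3^{d+1}τ♮)`.
[cite: Balaban1983RegularityDecay, (2.22) p.579, Corollary 2.3 (2.30) pp.580–581, case A = 0, shape] [folklore] -/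
theorem twoCutoffLine_inv_entry_decay_fineRegion (hsmall : (3 : ℝ) ^ (d + 1) * lineTau d L M a < 1)
    (x y : ↥((fineDom L (reg (M * n) K C)).image (blk L))) {N : ℕ} (hN : 1 ≤ N)
    (hfar : ∃ μ, (((2 * N + 3) * (M * n) + n : ℕ) : ℤ) ≤ |x.1 μ - y.1 μ|) :
    |(twoCutoffLine (isBlockUnion_fine (isBlockUnion_lineRegion K C hn M)) n a s)⁻¹ x y| ≤
      (3 : ℝ) ^ (d + 1) * (1 / min (lineSigma d L a) 1) * lineTau d L M a * (3 : ℝ) ^ (d + 1) *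
        ((3 : ℝ) ^ (d + 1) * lineTau d L M a) ^ (N - 1) / (1 - (3 : ℝ) ^ (d + 1) * lineTau d L M a) :=
  twoCutoffLine_inv_entry_decay_region K C hn hM (isBlockUnion_lineRegion K C hn M) (image_blk_lineRegion K C n M) ha hs0 hs1 hsmall
    x y hN hfar

end Concrete

end Summit.QuantumFields.BalabanUV.T4Continuum.NE7K1LinWalkLineRegion

end
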